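import Mathlib
import Summits.MatrixMultiplication.MatrixMultiplication.Theses.CondensationDistance
import Summits.MatrixMultiplication.MatrixMultiplication.Theorems.ShortCondensation.Negative.ShortCondensationFalseOfStaticWaistBound
import Summits.MatrixMultiplication.MatrixMultiplication.Theorems.CondensationDistanceTightToShort

/-!
# `TightCondensation` is false modulo the AUX-FREE static waist bound

`TightCondensation` (stmt-MatrixMultiplication-15937) is the `m' = n` (Dodgson-tight, no auxiliary columns)
form of `ShortCondensation`.  The kill chain of
`Theorems/ShortCondensation/Negative/ShortCondensationFalseOfStaticWaistBound.lean` specialises to it with a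
WEAKER hypothesis: `StaticWaistBoundTight`, the static generating-waist conjecture for the square-bordered
generic matrix `[X | Y]`, `X, Y ∈ ℂ^{n×n}` only (the `c = 1` slice of `StaticWaistBound`).  This is the form
supported by all exact data so far (minimal waists at every computed size are Sylvester frames of size
`(n-k)²+1`, cf. the item's evidence `WaistCompute.md`, `AuxColumnsN4.md`).

* `StaticWaistBoundTight` : the aux-free conjecture (`H₁`);
* `staticWaistBoundTight_of_staticWaistBound : StaticWaistBound → StaticWaistBoundTight`;
* `TightCondensation_false_of_StaticWaistBoundTight : StaticWaistBoundTight → ¬ TightCondensation` (the cut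
  lemma `waistCut_mem` at `m' = n`, `ε := δ/2`);
* `TightCondensation_false_of_StaticWaistBound : StaticWaistBound → ¬ TightCondensation`.

No refutation is claimed: `H₁` is not proved here.  [folklore]
-/

set_option linter.dupNamespace false

namespace Summit.MatrixMultiplication.MatrixMultiplication.Theorems.TightCondensation

open Summit.MatrixMultiplication.MatrixMultiplication.Theses.CondensationDistance
open Summit.MatrixMultiplication.MatrixMultiplication.Theorems.ShortCondensation

/-- **`H₁`, the aux-free static generating-waist bound.**  There is `δ > 0` such that for all large `n`:
every family `W` of `n`-subsets of `Fin (n + n)` of level `≥ 2` (level = number of `Y`-columns used, i.e.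
`W` is a family of minors of the generic `Y ∈ ℂ^{n×n}` of sizes `≥ 2`) over which `det X` — equivalently,
by the framing `[1 | X]⁻¹`-twist, `det Y` up to the frame — is a *rational waist tower* (`det X` and every
member of level `≥ k+2` lie in `ℂ(level-{k,k+1} members)` for every `2 ≤ k ≤ n-2`) has at least `n^(2+δ)`
members.  This is `StaticWaistBound` at `m' = n`; Dodgson condensation shows `#W ≤ n³` is possible
(`staticWaistBound_premise_dodgson`).
[topic: Computability/AlgebraicComplexity — generating sets of minors for the generic determinant] -/
def StaticWaistBoundTight : Prop :=
  ∃ δ : ℝ, 0 < δ ∧ ∃ n₁ : ℕ, ∀ n ≥ n₁, ∀ W : Finset (Finset (Fin (n + n))),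
    (∀ J ∈ W, J.card = n ∧ 2 ≤ (J.filter fun x : Fin (n + n) => n ≤ x.val).card) →
    (∀ k : ℕ, 2 ≤ k → k + 2 ≤ n →
      algebraMap (MvPolynomial (Fin n × Fin n) ℂ) (FractionRing (MvPolynomial (Fin n × Fin n) ℂ))
          (Matrix.det (Matrix.of fun i j : Fin n => MvPolynomial.X (i, Fin.castLE (le_refl n) j))) ∈
        waistField n n W k ∧
      ∀ J ∈ W, k + 2 ≤ (J.filter fun x : Fin (n + n) => n ≤ x.val).card →
        waistCoord n n J ∈ waistField n n W k) →
    (n : ℝ) ^ (2 + δ) ≤ (W.card : ℝ)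

/-- `H → H₁`: the `c = 1`, `m' = n` slice. [folklore] -/
theorem staticWaistBoundTight_of_staticWaistBound (H : StaticWaistBound) : StaticWaistBoundTight := by
  obtain ⟨δ, hδ, hH⟩ := H
  obtain ⟨n₁, hn₁⟩ := hH 1
  exact ⟨δ, hδ, n₁, fun n hn W hWn hWk => hn₁ n hn n (le_refl n) (by simp) W hWn hWk⟩

/-- **Kill chain, tight form**: `H₁ → ¬ TightCondensation`.  Take `ε := δ/2`; a valid listing of length
`l ≤ n^(2+δ/2)` in `J(2n,n)` reaching the complement `[n,2n)` yields (cut lemma) a rational waist tower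
`W` with `#W ≤ l`, so `n^(2+δ) ≤ l ≤ n^(2+δ/2)`, absurd for `n ≥ 2`. [folklore] -/
theorem TightCondensation_false_of_StaticWaistBoundTight (H : StaticWaistBoundTight) :
    ¬ TightCondensation := by
  intro hT
  obtain ⟨δ, hδ, n₁, hn₁⟩ := H
  obtain ⟨n₀, hc⟩ := hT (δ / 2) (half_pos hδ)
  set N : ℕ := max (max n₀ n₁) 2 with hN
  have hN₀ : n₀ ≤ N := (le_max_left _ _).trans (le_max_left _ _)
  have hN₁ : n₁ ≤ N := (le_max_right _ _).trans (le_max_left _ _)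
  have hN₂ : 2 ≤ N := le_max_right _ _
  obtain ⟨l, f, hl, hvalid, htarget⟩ := hc N hN₀
  have htarget' : ∃ i : Fin l, f i =
      Finset.univ.filter fun x : Fin (N + N) => N ≤ x.val ∧ x.val < 2 * N := by
    obtain ⟨i, hi⟩ := htarget
    refine ⟨i, ?_⟩
    rw [hi]
    exact Finset.filter_congr fun x _ => ⟨fun h => ⟨h, by omega⟩, fun h => h.1⟩
  obtain ⟨W, hWl, hWn, hWk⟩ := staticWaistBound_premise_of_listing (le_refl N) hvalid htarget'
  have key := hn₁ N hN₁ W hWn hWk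
  have h1 : (W.card : ℝ) ≤ (l : ℝ) := by exact_mod_cast hWl
  have h2 : (N : ℝ) ^ (2 + δ / 2) < (N : ℝ) ^ (2 + δ) :=
    Real.rpow_lt_rpow_of_exponent_lt (by exact_mod_cast (show 1 < N by omega)) (by linarith)
  linarith

/-- `H → ¬ TightCondensation` (either through `H₁`, or through `TightToShort_proof` and the short form).
[folklore] -/
theorem TightCondensation_false_of_StaticWaistBound (H : StaticWaistBound) : ¬ TightCondensation :=
  TightCondensation_false_of_StaticWaistBoundTight (staticWaistBoundTight_of_staticWaistBound H)

end Summit.MatrixMultiplication.MatrixMultiplication.Theorems.TightCondensation
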